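import Summits.QuantumFields.YangMills.Theorems.BalabanUVNodesN15KingModelFullPropagatorOperatorHolderRate
import Summits.QuantumFields.YangMills.Theorems.BalabanUVNodesN15KingModelFullPropagatorOperatorEntries
import Literature.MathematicalPhysics.QuantumFieldTheory.King1986.PropagatorDerivHolderSupNorm

/-!
# BalabanUVNodes ∕ N15 — THE KING-MODEL RUNG, CURVED EDITION (PART U-v): THE η-RATE OF THE (3.43)-TYPE HÖLDER ENTRY OF THE GRADIENT — the
# two-spacing difference of the η-GRADIENTS `DΔ_μ(x′) = ∂^{η′}_μ(A₀′⁻¹(λ∘π))(x′) − (∂^η_μA₀⁻¹λ)(πx′)` of King's full `A = 0` propagators is Hölder of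
# order `α` on unit cubes WITH THE RATE `θ^{K(1−α∕α₀)}`: `|DΔ_μ(x″) − DΔ_μ(x′)| ≤ C·(θ^K)^{1−α∕α₀}·(|x′ − x″|∕N′)^α·‖λ‖_∞` for `|x′ − x″| ≥ L^n`
# (`θ = L^{−γ∕2}`, `0 ≤ α ≤ α₀ < 1`), uniformly in `K`, `n`, the volume and the mass
# (Track A, DAG node N15 = NE2; FAN-OUT v1.1 §N15 s3 «KING-MODEL RUNG … + the one-line statement of what the curved case adds»)

HONEST FRAMING.  Count-neutral kernel bookkeeping (cell `pub-ymgap`, seat `pub-ymgap-dag-n15-e` g9; `--supports stmt-QuantumFields-20544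
--as helper` = K3⁷ `SpineGivenEndpointR13SepCoPH`, WORDS-143).  TEMPLATE LITERATURE, `A = 0`: C. King's scalar U(1)-Higgs MODEL on finite tori ([King1986]
(2.13) p. 653, Theorem 3.3 (3.8) p. 656, (3.62) p. 663, Prop. 3.8 (3.71) p. 664 lines 2 and 4, p. 664 «x′ ∈ B^n(x)»), NOT Bałaban's covariant objects;
[Balaban1983RegularityDecay] Theorem (1.9) p. 573 (the Hölder clause of the derivative; tree: `B4Thm19ZeroTorus(Uniform)`, King's spelling
`King1986.PropagatorDerivHolderSupNorm`); [Balaban1985BackgroundPropagators] Thm 3.1 (3.43) p. 398 (the Hölder entry `‖ζ∇_UGλ‖_β`, `0 ≤ β ≤ β₀ < 1`, of the GRADIENT;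
printed WITHOUT an η-rate; (3.44)–(3.45) concern the mixed object `∇_UG∇*_Uλ` and are NOT touched here), Thm 3.14 pp. 426–427 (the «difference operator with an additional factor» template).  The statement below is an NE2-type HÖLDER-LAYER
estimate for the GRADIENT in the model, NOT a printed proposition and NOT one of the typed `T4EtaRate` shapes (which carry the four sup entries of
(3.42) only); NE2⁺ is NOT PRINTED and not proved here; NOT a node discharge; nothing continuum ∕ ℝ⁴ ∕ OS ∕ mass-gap ∕ Clay.  0 `sorry`, 0 `def`,
standard axioms.

THE POINT.  Part Q4a `fullPropDOp_rate_printed` is the SUP rate of the gradient entry: `|DΔ_μ(x′)| ≤ C₁θ^K‖λ‖`, `θ = L^{−γ∕2}`, `0 ≤ γ < 1`, for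
`DΔ_μ(x′) := N′·[(A₀′⁻¹(λ∘π))(x′ + e_μ) − (A₀′⁻¹(λ∘π))(x′)] − N·[(A₀⁻¹λ)(πx′ + e_μ) − (A₀⁻¹λ)(πx′)]` ((3.71) line 2's pairing: the coarse gradient at the coarse
point under `x′`).  Part U-ii `fineOp_inv_deriv_holder_le_unif` is the rate-FREE Hölder bound of EACH gradient ((1.9), every `0 ≤ α₀ < 1`, both runs).
THIS FILE interpolates, exactly as part T-e did for the value entry:
* §1 `twoSpacingDOp_sub_le` — the rate-free Hölder bound of the DIFFERENCE: `|DΔ_μ(x″) − DΔ_μ(x′)| ≤ C·((|x′ − x″|∕N′)^{α₀} + (|πx′ − πx″|∕N)^{α₀})·‖λ‖`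
  (U-ii for both runs; the coarse pair vanishes when `πx′ = πx″`), and `≤ 3C·(|x′ − x″|∕N′)^{α₀}·‖λ‖` once `|x′ − x″| ≥ L^n`
  (King's pairing, part S-a `mul_tdistT_underPtN_le`: `|πx′ − πx″|∕N ≤ |x′ − x″|∕N′ + 1∕N ≤ 2|x′ − x″|∕N′`);
* §2 ★★ **`twoSpacingDOp_holder_rate`** — `0 ≤ γ < 1`, `0 < α₀ < 1`, `0 ≤ α ≤ α₀`: `∃ C > 0 ∀ K, n ≥ 1 ∀ cube 2L^e ∀ 0 < m² ≤ m₀² ∀ μ ∀ |λ| ≤ F ∀ x′, x″`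
  with `|x′ − x″| ≥ L^n`: `|DΔ_μ(x″) − DΔ_μ(x′)| ≤ C·(θ^K)^{1−α∕α₀}·(|x′ − x″|∕N′)^α·F` — the order-`α` Hölder quotient of the two-spacing difference of
  the η-gradients carries the RATE `θ^{K(1−α∕α₀)}` (part T-e `le_interpolate_rpow` between the sup rate at exponent `0` and the rate-free Hölder
  bound at exponent `α₀`, with weight `t = α∕α₀`).
WHY `|x′ − x″| ≥ L^n` (honest, as in part T-e): below the coarse spacing the coarse term `(∂A₀⁻¹λ)∘π` is constant on coarse blocks and jumps across
their faces; King's quotients (3.62) are taken on each run's own lattice.  WHY `α ≤ α₀ < 1`: (1.9) is printed for `α < 1` and its constant depends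
on the exponent, so the rate-free bound is taken at a FIXED `α₀ < 1` and the rate exponent is `γ(1 − α∕α₀)∕2`.
WHAT THE CURVED CASE ADDS (one line): an NE2⁺ HÖLDER LAYER for Bałaban's `∇_UG(U)λ` (a rate for the (3.43) entry, uniformly over `Reg335`) — neither
printed nor typed; the interpolation above would derive it from an NE2⁺ sup layer for `∇Gλ` plus the printed rate-free (3.43).
HONEST SCOPE.  (i) `A = 0`, periodic b.c., odd `L ≥ 3`, cubes `2L^e`, `K, n ≥ 1`, `0 < m² ≤ m₀²`; (ii) King's spelling of `A₀`, `A₀′`; forward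
η-gradients in the observation point; (iii) pairs with `L^n ≤ |x′ − x″|`; (iv) rate exponent `γ(1 − α∕α₀)∕2`, `0 ≤ γ < 1`, `0 < α₀ < 1`; (v) not
Bałaban's `G(U)`; not a discharge.
Locators: [King1986] (2.13) p. 653, (3.62) p. 663, (3.8) p. 656, Prop. 3.8 (3.71) p. 664, p. 664 («x′ ∈ B^n(x)»); [Balaban1983RegularityDecay] Theorem
(1.9) p. 573; [Balaban1985BackgroundPropagators] Thm 3.1 (3.43) p. 398, Thm 3.14 pp. 426–427 (template).
-/

noncomputable section

namespace Summit.QuantumFields.YangMills.BalabanUVNodes.N15KingModelRung.Curved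

open Real Finset Matrix
open Literature.MathematicalPhysics.QuantumFieldTheory.Balaban1983to89 (Params)
open Literature.MathematicalPhysics.QuantumFieldTheory.Balaban1983to89.B5Prop11Plancherel (Tor fine unitVec)
open Literature.MathematicalPhysics.QuantumFieldTheory.King1986 (aK aK_pos)
open Literature.MathematicalPhysics.QuantumFieldTheory.King1986.Torus (fineOp tdistT tdistT_nonneg tdistT_symm
  fineOp_inv_deriv_holder_le_unif)

variable {d : ℕ} (L : ℕ) [NeZero L]

/-! ## §1 The rate-free Hölder bound of the two-spacing difference of the gradients -/

/-- **The rate-free Hölder bound of the two-spacing difference of the η-gradients** `DΔ_μ = ∂^{η′}_μ(A₀′⁻¹(λ∘π)) − (∂^η_μA₀⁻¹λ)∘π`: for odd `L ≥ 3`,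
`a > 0`, `m₀² ≥ 0` and `0 ≤ α₀ < 1` there is `C > 0` with
`|DΔ_μ(x″) − DΔ_μ(x′)| ≤ C·((|x′ − x″|∕N′)^{α₀} + (|πx′ − πx″|∕N)^{α₀})·F` for EVERY `K, n ≥ 1`, cube `2L^e`, mass `0 < m² ≤ m₀²`, `|λ| ≤ F`, `μ` and
all fine `x′ ≠ x″` — [Ba 4] (1.9) in King's spelling (`fineOp_inv_deriv_holder_le_unif`) for the fine run at `(x′, x″)` and for the coarse run at
`(πx′, πx″)` (the coarse pair vanishes identically when `πx′ = πx″`). [cite: Balaban1983RegularityDecay, Theorem (1.9) p.573; King1986, Theorem 3.3 (3.8) p.656, (3.62) p.663, p.664 («x′ ∈ B^n(x)»)] -/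
theorem twoSpacingDOp_sub_le (hLodd : Odd L) (hL : 2 ≤ L) {a : ℝ} (ha : 0 < a) {m0sq : ℝ} (hm0 : 0 ≤ m0sq) {α₀ : ℝ}
    (hα0 : 0 ≤ α₀) (hα1 : α₀ < 1) :
    ∃ C : ℝ, 0 < C ∧ ∀ (K : ℕ), 1 ≤ K → ∀ (n : ℕ), 1 ≤ n →
      ∀ (e : ℕ) (M : Fin (d + 1) → ℕ) [∀ μ, NeZero (M μ)], (∀ μ, M μ = 2 * L ^ e) →
      ∀ (msq : ℝ), 0 < msq → msq ≤ m0sq → ∀ (μ : Fin (d + 1))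
      (lam : Tor (fine (L ^ K) M) → ℝ) (F : ℝ), (∀ y, |lam y| ≤ F) → ∀ x' x'' : Tor (fine (L ^ n * L ^ K) M), x'' ≠ x' →
        |(((L ^ n * L ^ K : ℕ) : ℝ) *
              (((fineOp (L ^ n * L ^ K) M (aK a L (K + n)) (((L ^ n * L ^ K : ℕ) : ℝ) ^ 2) msq)⁻¹
                  *ᵥ (fun y' => lam (underPtN L K n M y'))) (x'' + unitVec (fine (L ^ n * L ^ K) M) μ)
                - ((fineOp (L ^ n * L ^ K) M (aK a L (K + n)) (((L ^ n * L ^ K : ℕ) : ℝ) ^ 2) msq)⁻¹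
                  *ᵥ (fun y' => lam (underPtN L K n M y'))) x'')
            - ((L ^ K : ℕ) : ℝ) *
              (((fineOp (L ^ K) M (aK a L K) (((L ^ K : ℕ) : ℝ) ^ 2) msq)⁻¹ *ᵥ lam) (underPtN L K n M x'' + unitVec (fine (L ^ K) M) μ)
                - ((fineOp (L ^ K) M (aK a L K) (((L ^ K : ℕ) : ℝ) ^ 2) msq)⁻¹ *ᵥ lam) (underPtN L K n M x'')))
          - (((L ^ n * L ^ K : ℕ) : ℝ) *
              (((fineOp (L ^ n * L ^ K) M (aK a L (K + n)) (((L ^ n * L ^ K : ℕ) : ℝ) ^ 2) msq)⁻¹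
                  *ᵥ (fun y' => lam (underPtN L K n M y'))) (x' + unitVec (fine (L ^ n * L ^ K) M) μ)
                - ((fineOp (L ^ n * L ^ K) M (aK a L (K + n)) (((L ^ n * L ^ K : ℕ) : ℝ) ^ 2) msq)⁻¹
                  *ᵥ (fun y' => lam (underPtN L K n M y'))) x')
            - ((L ^ K : ℕ) : ℝ) *
              (((fineOp (L ^ K) M (aK a L K) (((L ^ K : ℕ) : ℝ) ^ 2) msq)⁻¹ *ᵥ lam) (underPtN L K n M x' + unitVec (fine (L ^ K) M) μ)
                - ((fineOp (L ^ K) M (aK a L K) (((L ^ K : ℕ) : ℝ) ^ 2) msq)⁻¹ *ᵥ lam) (underPtN L K n M x')))|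
          ≤ C * ((tdistT (fine (L ^ n * L ^ K) M) x' x'' / ((L ^ n * L ^ K : ℕ) : ℝ)) ^ α₀
              + (tdistT (fine (L ^ K) M) (underPtN L K n M x') (underPtN L K n M x'') / ((L ^ K : ℕ) : ℝ)) ^ α₀) * F := by
  have hL1 : 1 < L := by omega
  have hL0 : (0 : ℝ) < L := by exact_mod_cast (show 0 < L by omega)
  obtain ⟨C₂, hC₂, H₂⟩ := fineOp_inv_deriv_holder_le_unif (d + 1) L (by omega) ⟨hLodd, hL1⟩ ha hm0 hα0 hα1
  refine ⟨C₂, hC₂, ?_⟩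
  intro K hK n hn e M _ hM msq hmsq hcap μ lam F hF x' x'' hne
  -- the two parameter records (fine run: `K + n` levels; coarse run: `K` levels), cube `2L^e`
  set Pf : Params := ⟨d + 1, L, e, K + n, by omega, ⟨hLodd, hL1⟩⟩ with hPf
  set Pc : Params := ⟨d + 1, L, e, K, by omega, ⟨hLodd, hL1⟩⟩ with hPc
  have hMf : ∀ μ, M μ = Pf.sitesPerDir Pf.K := fun μ => by rw [hM μ]; simp [hPf, Params.sitesPerDir]
  have hMc : ∀ μ, M μ = Pc.sitesPerDir Pc.K := fun μ => by rw [hM μ]; simp [hPc, Params.sitesPerDir]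
  have hNf : L ^ n * L ^ K = Pf.L ^ Pf.K := by simp only [hPf]; rw [pow_add, mul_comm]
  have hNc : L ^ K = Pc.L ^ Pc.K := by simp only [hPc]
  have hFc : ∀ y', |lam (underPtN L K n M y')| ≤ F := fun y' => hF _
  have hF0 : 0 ≤ F := (abs_nonneg _).trans (hF (underPtN L K n M x'))
  set q : ℝ := tdistT (fine (L ^ n * L ^ K) M) x' x'' / ((L ^ n * L ^ K : ℕ) : ℝ) with hqdef
  set qc : ℝ := tdistT (fine (L ^ K) M) (underPtN L K n M x') (underPtN L K n M x'') / ((L ^ K : ℕ) : ℝ) with hqcdef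
  have hq0 : 0 ≤ q := div_nonneg (tdistT_nonneg _ _ _) (Nat.cast_nonneg _)
  have hqc0 : 0 ≤ qc := div_nonneg (tdistT_nonneg _ _ _) (Nat.cast_nonneg _)
  -- abbreviations for the four gradients
  set u2 : ℝ := ((L ^ n * L ^ K : ℕ) : ℝ) *
      (((fineOp (L ^ n * L ^ K) M (aK a L (K + n)) (((L ^ n * L ^ K : ℕ) : ℝ) ^ 2) msq)⁻¹
          *ᵥ (fun y' => lam (underPtN L K n M y'))) (x'' + unitVec (fine (L ^ n * L ^ K) M) μ)
        - ((fineOp (L ^ n * L ^ K) M (aK a L (K + n)) (((L ^ n * L ^ K : ℕ) : ℝ) ^ 2) msq)⁻¹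
          *ᵥ (fun y' => lam (underPtN L K n M y'))) x'') with hu2
  set u1 : ℝ := ((L ^ n * L ^ K : ℕ) : ℝ) *
      (((fineOp (L ^ n * L ^ K) M (aK a L (K + n)) (((L ^ n * L ^ K : ℕ) : ℝ) ^ 2) msq)⁻¹
          *ᵥ (fun y' => lam (underPtN L K n M y'))) (x' + unitVec (fine (L ^ n * L ^ K) M) μ)
        - ((fineOp (L ^ n * L ^ K) M (aK a L (K + n)) (((L ^ n * L ^ K : ℕ) : ℝ) ^ 2) msq)⁻¹
          *ᵥ (fun y' => lam (underPtN L K n M y'))) x') with hu1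
  set v2 : ℝ := ((L ^ K : ℕ) : ℝ) *
      (((fineOp (L ^ K) M (aK a L K) (((L ^ K : ℕ) : ℝ) ^ 2) msq)⁻¹ *ᵥ lam) (underPtN L K n M x'' + unitVec (fine (L ^ K) M) μ)
        - ((fineOp (L ^ K) M (aK a L K) (((L ^ K : ℕ) : ℝ) ^ 2) msq)⁻¹ *ᵥ lam) (underPtN L K n M x'')) with hv2
  set v1 : ℝ := ((L ^ K : ℕ) : ℝ) *
      (((fineOp (L ^ K) M (aK a L K) (((L ^ K : ℕ) : ℝ) ^ 2) msq)⁻¹ *ᵥ lam) (underPtN L K n M x' + unitVec (fine (L ^ K) M) μ)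
        - ((fineOp (L ^ K) M (aK a L K) (((L ^ K : ℕ) : ℝ) ^ 2) msq)⁻¹ *ᵥ lam) (underPtN L K n M x')) with hv1
  -- fine run: (1.9) at `(x′, x″)`, solved for the difference
  have hfineW := H₂ Pf rfl rfl (by show 1 ≤ K + n; omega) msq hmsq.le hcap M hMf (L ^ n * L ^ K) hNf
    (fun y' => lam (underPtN L K n M y')) F hFc x' x'' hne μ
  have hfine : |u2 - u1| ≤ C₂ * q ^ α₀ * F := by
    -- `|u2 − u1| = q^{α₀}·(q^{−α₀}·|u2 − u1|)` since `q > 0`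
    have hq1 : 0 < q := by
      have h1 : 1 ≤ tdistT (fine (L ^ n * L ^ K) M) x' x'' := by
        rw [tdistT_symm]; exact one_le_tdistT_of_ne _ hne
      exact div_pos (by linarith) (by positivity)
    have hw : 0 < q ^ α₀ := Real.rpow_pos_of_pos hq1 _
    have e : |u2 - u1| = q ^ α₀ * (q ^ (-α₀) * |u2 - u1|) := by
      rw [← mul_assoc, Real.rpow_neg hq1.le, mul_inv_cancel₀ hw.ne', one_mul]
    rw [e]
    calc q ^ α₀ * (q ^ (-α₀) * |u2 - u1|) ≤ q ^ α₀ * (C₂ * F) := mul_le_mul_of_nonneg_left hfineW hw.le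
      _ = C₂ * q ^ α₀ * F := by ring
  -- coarse run: (1.9) at `(πx′, πx″)` when distinct, else the pair vanishes
  have hcoarse : |v2 - v1| ≤ C₂ * qc ^ α₀ * F := by
    by_cases hπ : underPtN L K n M x'' = underPtN L K n M x'
    · have h0 : v2 - v1 = 0 := by rw [hv2, hv1, hπ]; ring
      rw [h0, abs_zero]
      exact mul_nonneg (mul_nonneg hC₂.le (Real.rpow_nonneg hqc0 _)) hF0
    · have hcW := H₂ Pc rfl rfl hK msq hmsq.le hcap M hMc (L ^ K) hNc lam F hF (underPtN L K n M x') (underPtN L K n M x'') hπ μ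
      have hqc1 : 0 < qc := by
        have h1 : 1 ≤ tdistT (fine (L ^ K) M) (underPtN L K n M x') (underPtN L K n M x'') := by
          rw [tdistT_symm]; exact one_le_tdistT_of_ne _ hπ
        exact div_pos (by linarith) (by positivity)
      have hw : 0 < qc ^ α₀ := Real.rpow_pos_of_pos hqc1 _
      have e : |v2 - v1| = qc ^ α₀ * (qc ^ (-α₀) * |v2 - v1|) := by
        rw [← mul_assoc, Real.rpow_neg hqc1.le, mul_inv_cancel₀ hw.ne', one_mul]
      rw [e]
      calc qc ^ α₀ * (qc ^ (-α₀) * |v2 - v1|) ≤ qc ^ α₀ * (C₂ * F) := mul_le_mul_of_nonneg_left hcW hw.le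
        _ = C₂ * qc ^ α₀ * F := by ring
  have e : (u2 - v2) - (u1 - v1) = (u2 - u1) - (v2 - v1) := by ring
  rw [e]
  calc |(u2 - u1) - (v2 - v1)| ≤ |u2 - u1| + |v2 - v1| := abs_sub _ _
    _ ≤ C₂ * q ^ α₀ * F + C₂ * qc ^ α₀ * F := add_le_add hfine hcoarse
    _ = C₂ * (q ^ α₀ + qc ^ α₀) * F := by ring

/-! ## §2 The Hölder quotient of the two-spacing difference of the gradients carries a rate -/

/-- **THE η-RATE OF THE (3.43)-TYPE HÖLDER ENTRY OF THE GRADIENT** (`0 ≤ γ < 1`, `0 < α₀ < 1`, `0 ≤ α ≤ α₀`): for odd `L ≥ 3`, `a > 0`, `m₀² ≥ 0`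
there is `C > 0` (a function of `d, L, a, m₀², γ, α₀`) such that for EVERY `K ≥ 1`, `n ≥ 1`, cube `2L^e`, mass `0 < m² ≤ m₀²`, direction `μ`, source
`|λ| ≤ F` on the coarse lattice and all fine points `x′, x″` with `|x′ − x″| ≥ L^n` (`≥ η` in unit coordinates), the two-spacing difference of the
η-gradients `DΔ_μ = ∂^{η′}_μ(A₀′⁻¹(λ∘π)) − (∂^η_μA₀⁻¹λ)∘π` satisfies
`|DΔ_μ(x″) − DΔ_μ(x′)| ≤ C·(θ^K)^{1−α∕α₀}·(|x′ − x″|∕N′)^α·F`, `θ = L^{−γ∕2}` — the order-`α` Hölder quotient of the two-spacing difference of the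
gradients on unit cubes carries the RATE `θ^{K(1−α∕α₀)}`: interpolation (part T-e `le_interpolate_rpow`) between part Q4a's sup rate
`|DΔ_μ| ≤ C₁θ^K F` and §1 (`≤ 3C₂(|x′−x″|∕N′)^{α₀}F` once `|x′ − x″| ≥ L^n`).  An NE2-type HÖLDER-LAYER statement for the GRADIENT of King's full
`A = 0` propagator, decided in the model; not printed, not typed by `T4EtaRate`.
[cite: King1986, (3.62) p.663, Prop. 3.8 (3.71) p.664 (lines 2, 4); Balaban1983RegularityDecay, Theorem (1.9) p.573; Balaban1985BackgroundPropagators, Thm 3.1 (3.43) p.398, Thm 3.14 pp.426–427] -/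
theorem twoSpacingDOp_holder_rate (hLodd : Odd L) (hL : 2 ≤ L) {a : ℝ} (ha : 0 < a) {m0sq : ℝ} (hm0 : 0 ≤ m0sq) {γ : ℝ}
    (hγ0 : 0 ≤ γ) (hγ1 : γ < 1) {α₀ : ℝ} (hα₀0 : 0 < α₀) (hα₀1 : α₀ < 1) {α : ℝ} (hα0 : 0 ≤ α) (hα1 : α ≤ α₀) :
    ∃ C : ℝ, 0 < C ∧ ∀ (K : ℕ), 1 ≤ K → ∀ (n : ℕ), 1 ≤ n →
      ∀ (e : ℕ) (M : Fin (d + 1) → ℕ) [∀ μ, NeZero (M μ)], (∀ μ, M μ = 2 * L ^ e) →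
      ∀ (msq : ℝ), 0 < msq → msq ≤ m0sq → ∀ (μ : Fin (d + 1))
      (lam : Tor (fine (L ^ K) M) → ℝ) (F : ℝ), (∀ y, |lam y| ≤ F) → ∀ x' x'' : Tor (fine (L ^ n * L ^ K) M),
        ((L ^ n : ℕ) : ℝ) ≤ tdistT (fine (L ^ n * L ^ K) M) x' x'' →
        |(((L ^ n * L ^ K : ℕ) : ℝ) *
              (((fineOp (L ^ n * L ^ K) M (aK a L (K + n)) (((L ^ n * L ^ K : ℕ) : ℝ) ^ 2) msq)⁻¹
                  *ᵥ (fun y' => lam (underPtN L K n M y'))) (x'' + unitVec (fine (L ^ n * L ^ K) M) μ)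
                - ((fineOp (L ^ n * L ^ K) M (aK a L (K + n)) (((L ^ n * L ^ K : ℕ) : ℝ) ^ 2) msq)⁻¹
                  *ᵥ (fun y' => lam (underPtN L K n M y'))) x'')
            - ((L ^ K : ℕ) : ℝ) *
              (((fineOp (L ^ K) M (aK a L K) (((L ^ K : ℕ) : ℝ) ^ 2) msq)⁻¹ *ᵥ lam) (underPtN L K n M x'' + unitVec (fine (L ^ K) M) μ)
                - ((fineOp (L ^ K) M (aK a L K) (((L ^ K : ℕ) : ℝ) ^ 2) msq)⁻¹ *ᵥ lam) (underPtN L K n M x'')))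
          - (((L ^ n * L ^ K : ℕ) : ℝ) *
              (((fineOp (L ^ n * L ^ K) M (aK a L (K + n)) (((L ^ n * L ^ K : ℕ) : ℝ) ^ 2) msq)⁻¹
                  *ᵥ (fun y' => lam (underPtN L K n M y'))) (x' + unitVec (fine (L ^ n * L ^ K) M) μ)
                - ((fineOp (L ^ n * L ^ K) M (aK a L (K + n)) (((L ^ n * L ^ K : ℕ) : ℝ) ^ 2) msq)⁻¹
                  *ᵥ (fun y' => lam (underPtN L K n M y'))) x')
            - ((L ^ K : ℕ) : ℝ) *
              (((fineOp (L ^ K) M (aK a L K) (((L ^ K : ℕ) : ℝ) ^ 2) msq)⁻¹ *ᵥ lam) (underPtN L K n M x' + unitVec (fine (L ^ K) M) μ)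
                - ((fineOp (L ^ K) M (aK a L K) (((L ^ K : ℕ) : ℝ) ^ 2) msq)⁻¹ *ᵥ lam) (underPtN L K n M x')))|
          ≤ C * ((((L : ℝ) ^ (-(γ / 2))) ^ K) ^ (1 - α / α₀))
              * (tdistT (fine (L ^ n * L ^ K) M) x' x'' / ((L ^ n * L ^ K : ℕ) : ℝ)) ^ α * F := by
  have hL0 : (0 : ℝ) < L := by exact_mod_cast (show 0 < L by omega)
  obtain ⟨C₁, δ₁, hC₁, hδ₁, H₁⟩ := fullPropDOp_rate_printed (d := d) L hLodd hL ha hm0 hγ0 hγ1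
  obtain ⟨C₂, hC₂, H₂⟩ := twoSpacingDOp_sub_le (d := d) L hLodd hL ha hm0 hα₀0.le hα₀1
  set A : ℝ := 3 * max C₁ C₂ with hAdef
  have hA : 0 < A := by have := le_max_left C₁ C₂; positivity
  refine ⟨A, hA, ?_⟩
  intro K hK n hn e M _ hM msq hmsq hcap μ lam F hF x' x'' hres
  set θK : ℝ := ((L : ℝ) ^ (-(γ / 2))) ^ K with hθKdef
  have hθK0 : 0 ≤ θK := pow_nonneg (Real.rpow_nonneg hL0.le _) K
  set r' : ℝ := tdistT (fine (L ^ n * L ^ K) M) x' x'' with hr'def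
  set r : ℝ := tdistT (fine (L ^ K) M) (underPtN L K n M x') (underPtN L K n M x'') with hrdef
  set N' : ℝ := ((L ^ n * L ^ K : ℕ) : ℝ) with hN'def
  set Nc : ℝ := ((L ^ K : ℕ) : ℝ) with hNcdef
  set Ln : ℝ := ((L ^ n : ℕ) : ℝ) with hLndef
  have hLn1 : 1 ≤ Ln := by rw [hLndef]; exact_mod_cast Nat.one_le_pow n L (by omega)
  have hLn0 : 0 < Ln := by linarith
  have hNc0 : 0 < Nc := by rw [hNcdef]; exact_mod_cast pow_pos (show 0 < L by omega) K
  have hN'eq : N' = Ln * Nc := by rw [hN'def, hLndef, hNcdef]; push_cast; ring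
  have hN'0 : 0 < N' := by rw [hN'eq]; positivity
  have hF0 : 0 ≤ F := (abs_nonneg _).trans (hF (underPtN L K n M x'))
  set q : ℝ := r' / N' with hqdef
  have hq0 : 0 ≤ q := div_nonneg (tdistT_nonneg _ x' x'') hN'0.le
  -- the pair is resolved by the coarse lattice: `x′ ≠ x″` and `1∕Nc ≤ q`
  have hne : x'' ≠ x' := by
    intro h
    have h0 : r' = 0 := by rw [hr'def, h]; exact Literature.MathematicalPhysics.QuantumFieldTheory.King1986.Torus.tdistT_self _ _
    have : Ln ≤ r' := hres
    linarith
  have hNq : 1 / Nc ≤ q := by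
    rw [hqdef, hN'eq, div_le_div_iff₀ hNc0 (by positivity), one_mul]
    calc Ln * Nc = Nc * Ln := mul_comm _ _
      _ ≤ r' * Nc := by rw [mul_comm r']; exact mul_le_mul_of_nonneg_left hres hNc0.le
  -- the coarse quotient is at most `2q`: `r∕Nc ≤ r′∕N′ + 1∕Nc`
  have hpair : Ln * r ≤ r' + (Ln - 1) := mul_tdistT_underPtN_le L K n M x' x''
  have hrc : r / Nc ≤ 2 * q := by
    have h1 : r / Nc ≤ q + 1 / Nc := by
      rw [hqdef, hN'eq, div_add_div _ _ (by positivity) hNc0.ne', div_le_div_iff₀ hNc0 (by positivity)]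
      have e1 : r * (Ln * Nc * Nc) = (Ln * r) * Nc * Nc := by ring
      have e2 : (r' * Nc + Ln * Nc * 1) * Nc = (r' + Ln) * Nc * Nc := by ring
      rw [e1, e2]
      exact mul_le_mul_of_nonneg_right (mul_le_mul_of_nonneg_right (by linarith) hNc0.le) hNc0.le
    linarith
  -- (a) the sup rate, twice (part Q4a at `D = 0`)
  have hsup : ∀ z' : Tor (fine (L ^ n * L ^ K) M),
      |((L ^ n * L ^ K : ℕ) : ℝ) *
            (((fineOp (L ^ n * L ^ K) M (aK a L (K + n)) (((L ^ n * L ^ K : ℕ) : ℝ) ^ 2) msq)⁻¹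
                *ᵥ (fun y' => lam (underPtN L K n M y'))) (z' + unitVec (fine (L ^ n * L ^ K) M) μ)
              - ((fineOp (L ^ n * L ^ K) M (aK a L (K + n)) (((L ^ n * L ^ K : ℕ) : ℝ) ^ 2) msq)⁻¹
                *ᵥ (fun y' => lam (underPtN L K n M y'))) z')
        - ((L ^ K : ℕ) : ℝ) *
            (((fineOp (L ^ K) M (aK a L K) (((L ^ K : ℕ) : ℝ) ^ 2) msq)⁻¹ *ᵥ lam) (underPtN L K n M z' + unitVec (fine (L ^ K) M) μ)
              - ((fineOp (L ^ K) M (aK a L K) (((L ^ K : ℕ) : ℝ) ^ 2) msq)⁻¹ *ᵥ lam) (underPtN L K n M z'))|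
        ≤ C₁ * θK * F := by
    intro z'
    have h := H₁ K hK n hn e M hM msq hmsq hcap μ lam F hF 0 z' (fun y _ => by rw [Nat.cast_zero]; exact tdistT_nonneg M _ _)
    rwa [Nat.cast_zero, mul_zero, neg_zero, Real.exp_zero, mul_one] at h
  have hs2 := hsup x''
  have hs1 := hsup x'
  -- (b) the rate-free Hölder bound
  have hb := H₂ K hK n hn e M hM msq hmsq hcap μ lam F hF x' x'' hne
  set X : ℝ := |(((L ^ n * L ^ K : ℕ) : ℝ) *
              (((fineOp (L ^ n * L ^ K) M (aK a L (K + n)) (((L ^ n * L ^ K : ℕ) : ℝ) ^ 2) msq)⁻¹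
                  *ᵥ (fun y' => lam (underPtN L K n M y'))) (x'' + unitVec (fine (L ^ n * L ^ K) M) μ)
                - ((fineOp (L ^ n * L ^ K) M (aK a L (K + n)) (((L ^ n * L ^ K : ℕ) : ℝ) ^ 2) msq)⁻¹
                  *ᵥ (fun y' => lam (underPtN L K n M y'))) x'')
            - ((L ^ K : ℕ) : ℝ) *
              (((fineOp (L ^ K) M (aK a L K) (((L ^ K : ℕ) : ℝ) ^ 2) msq)⁻¹ *ᵥ lam) (underPtN L K n M x'' + unitVec (fine (L ^ K) M) μ)
                - ((fineOp (L ^ K) M (aK a L K) (((L ^ K : ℕ) : ℝ) ^ 2) msq)⁻¹ *ᵥ lam) (underPtN L K n M x'')))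
          - (((L ^ n * L ^ K : ℕ) : ℝ) *
              (((fineOp (L ^ n * L ^ K) M (aK a L (K + n)) (((L ^ n * L ^ K : ℕ) : ℝ) ^ 2) msq)⁻¹
                  *ᵥ (fun y' => lam (underPtN L K n M y'))) (x' + unitVec (fine (L ^ n * L ^ K) M) μ)
                - ((fineOp (L ^ n * L ^ K) M (aK a L (K + n)) (((L ^ n * L ^ K : ℕ) : ℝ) ^ 2) msq)⁻¹
                  *ᵥ (fun y' => lam (underPtN L K n M y'))) x')
            - ((L ^ K : ℕ) : ℝ) *
              (((fineOp (L ^ K) M (aK a L K) (((L ^ K : ℕ) : ℝ) ^ 2) msq)⁻¹ *ᵥ lam) (underPtN L K n M x' + unitVec (fine (L ^ K) M) μ)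
                - ((fineOp (L ^ K) M (aK a L K) (((L ^ K : ℕ) : ℝ) ^ 2) msq)⁻¹ *ᵥ lam) (underPtN L K n M x')))| with hXdef
  -- the Hölder side as `A·F·Q` with `Q = q^{α₀}`
  set Q : ℝ := q ^ α₀ with hQdef
  have hQ0 : 0 ≤ Q := Real.rpow_nonneg hq0 _
  have hqc_le : (r / Nc) ^ α₀ ≤ 2 * Q := by
    have h1 : (r / Nc) ^ α₀ ≤ (2 * q) ^ α₀ :=
      Real.rpow_le_rpow (div_nonneg (tdistT_nonneg _ _ _) hNc0.le) hrc hα₀0.le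
    have h2 : (2 * q) ^ α₀ = (2 : ℝ) ^ α₀ * Q := by rw [hQdef, Real.mul_rpow (by norm_num) hq0]
    have h3 : (2 : ℝ) ^ α₀ ≤ 2 := by
      have := Real.rpow_le_rpow_of_exponent_le (by norm_num : (1 : ℝ) ≤ 2) hα₀1.le
      rwa [Real.rpow_one] at this
    calc (r / Nc) ^ α₀ ≤ (2 : ℝ) ^ α₀ * Q := by rw [← h2]; exact h1
      _ ≤ 2 * Q := mul_le_mul_of_nonneg_right h3 hQ0
  have h1 : X ≤ (A * F) * θK := by
    calc X ≤ C₁ * θK * F + C₁ * θK * F := (abs_sub _ _).trans (add_le_add hs2 hs1)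
      _ = 2 * C₁ * F * θK := by ring
      _ ≤ A * F * θK := by
          have : 2 * C₁ ≤ A := by rw [hAdef]; linarith [le_max_left C₁ C₂, hC₁.le]
          have := mul_le_mul_of_nonneg_right (mul_le_mul_of_nonneg_right this hF0) hθK0
          linarith
  have h2 : X ≤ (A * F) * Q := by
    calc X ≤ C₂ * (Q + (r / Nc) ^ α₀) * F := hb
      _ ≤ C₂ * (Q + 2 * Q) * F := mul_le_mul_of_nonneg_right (mul_le_mul_of_nonneg_left (by linarith) hC₂.le) hF0
      _ = 3 * C₂ * F * Q := by ring
      _ ≤ A * F * Q := by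
          have : 3 * C₂ ≤ A := by rw [hAdef]; linarith [le_max_right C₁ C₂]
          have := mul_le_mul_of_nonneg_right (mul_le_mul_of_nonneg_right this hF0) hQ0
          linarith
  -- interpolation with weight `t = α∕α₀ ∈ [0, 1]`: `θK^{1−t}·Q^t = θK^{1−α∕α₀}·q^α`
  set t : ℝ := α / α₀ with htdef
  have ht0 : 0 ≤ t := div_nonneg hα0 hα₀0.le
  have ht1 : t ≤ 1 := (div_le_one hα₀0).mpr hα1
  have hQt : Q ^ t = q ^ α := by
    rw [hQdef, ← Real.rpow_mul hq0, htdef, mul_div_cancel₀ _ hα₀0.ne']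
  have := le_interpolate_rpow (by positivity : 0 ≤ A * F) hθK0 hQ0 ht0 ht1 h1 h2
  calc X ≤ A * F * θK ^ (1 - t) * Q ^ t := this
    _ = A * θK ^ (1 - t) * q ^ α * F := by rw [hQt]; ring

end Summit.QuantumFields.YangMills.BalabanUVNodes.N15KingModelRung.Curved
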